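import Summits.AtomisticToContinuum.Crystallization.Theorems.FrustratedLawDichotomyStrainedPatchTaylorKband

/-!
# (P3b) `BeyondBallTail` REDUCED to an instance-only rim-mass count; the cap lemma (lens-5 g53, crux 27623 T-side, node T2-bent₁)

The last leaf of (T2-bent₁) after `…TaylorKband` is the geometric tail (P3b) `inBallFrozen ≤ frozenAvg + 10⁻⁵`.  Here: `frozenAvg − inBallFrozen =
Σ_{members a} ½·Σ_{k ∉ ball(c, 63/10)} W(r_ak) / #B_{z₁}(e a)` (`frozenAvg_sub_inBallFrozen`, `xSm_sub_matchSm`); a member lies within `9/5 + δ₀ = 37/20`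
of the centre (`dist_le_of_member`, fine chart), so a dropped partner has `r_ak > 63/10 − 37/20 = 89/20`, where ★ `Wrec_tail_lb : 89/20 ≤ r →
−3·10⁻⁵·(9/2 − r)² ≤ W(r)` (window `W = V·p`, `V ≥ −(1/6)(20/89)⁶`, `p = (16/27)(9/2 − r)²(r − 9/4)`, `0` beyond `9/2`) and `9/2 − r_ak ≤ d_a − 9/5`; hence
★★ `beyondBallTail_of_rimCapCount : RimCapCount → BeyondBallTail` with the WEIGHTED RIM-CAP COUNT `RimCapCount := Σ_{a member} (d_a − 9/5)²·#outer(a) /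
#B_{z₁}(e a) ≤ 2/3` (`outer(a)` = cluster sites beyond the chart ball within `9/2` of `z a`; unweighted sufficient form `FlatCapCount`, constant `266`).
§5 THE CAP LEMMA (crude, volume packing): an outer partner of a member lies within `123/100` of `p_a = z_c + (167/50)(z_a − z_c)` (polarization
`|X − μY|² = (1 − μ)|X|² + μ|X − Y|² + (μ² − μ)|Y|²` on `|X| > 63/10`, `|X − Y| < 9/2`, `|Y| ≤ 37/20`), so by `7/10`-separation and the Literature packing bound
`card_le_of_separated_of_dist_le`: ★★ `card_outer_le : #outer(a) ≤ 92`.  §6–7: with weights `≤ 1/400` this reduces (P3b-count) to the RIM MASS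
`RimMass := Σ_{rim members} 1/#B_{z₁}(e a) ≤ 26/9`, and — `e` being injective on members and mapping rim members (`d_a > 9/5`) to instance rim sites
(`7/4 < |z₁ b − z₁ c₁| ≤ 9/5`) — to the INSTANCE-ONLY statement ★ `InstanceRimMass := ∀ (z₁, c₁) ∈ 𝓘₁⁺, Σ_{b ∈ instRim} 1/#B_{z₁}(b) ≤ 26/9` (no cluster;
ideal fcc/hcp at any spacing `s ∈ [0.9, 1.25]` give `≤ 0.56`).  SEAMS: `taylorTwoBent1_of_rimCapCount`, ★★★ `taylorTwoBent1_of_instanceRimMass :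
InstanceRimMass → TaylorTwoBent1`.  NODE OF RECORD: (T2-bent₁) ⟸ (P3b-inst) `InstanceRimMass` [instance census / lattice counting] — every cluster-side piece PROVED.
-/

open scoped BigOperators Classical
open Summit.AtomisticToContinuum.Crystallization.Theorems.FrustratedLawDichotomyRangeCut (Sep)
open Summit.AtomisticToContinuum.Crystallization.Theorems.FrustratedLawDichotomyMotifLemmas
open Summit.AtomisticToContinuum.Crystallization.Theorems.FrustratedLawDichotomyAveragingCut
open Summit.AtomisticToContinuum.Crystallization.Theorems.FrustratedLawDichotomyAveragingRuleCap
open Summit.AtomisticToContinuum.Crystallization.Theorems.FrustratedLawDichotomyAveragingRuleTightFree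
open Summit.AtomisticToContinuum.Crystallization.Theorems.FrustratedLawDichotomyExemptAbsorptionRecord
open Summit.AtomisticToContinuum.Crystallization.Theorems.FrustratedLawDichotomySchurCut
open Literature.MathematicalPhysics.StatisticalMechanics (lennardJones lennardJones_nonpos)
open Summit.AtomisticToContinuum.Crystallization.Theorems.FrustratedLawDichotomyRuleToolkitGood
open Summit.AtomisticToContinuum.Crystallization.Theorems.FrustratedLawDichotomyStrainedPatchHomSplit
open Summit.AtomisticToContinuum.Crystallization.Theorems.FrustratedLawDichotomyStrainedPatchHomTermCalculus
open Summit.AtomisticToContinuum.Crystallization.Theorems.FrustratedLawDichotomyStrainedPatchChartFamilies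
open Summit.AtomisticToContinuum.Crystallization.Theorems.FrustratedLawDichotomyStrainedPatchChartFamiliesBent
open Summit.AtomisticToContinuum.Crystallization.Theorems.FrustratedLawDichotomyStrainedPatchChartFamiliesPinned
open Summit.AtomisticToContinuum.Crystallization.Theorems.FrustratedLawDichotomyStrainedPatchEnvelopeLaw
open Summit.AtomisticToContinuum.Crystallization.Theorems.FrustratedLawDichotomyStrainedPatchEnvelopeTaylor

open Summit.AtomisticToContinuum.Crystallization.Theorems.FrustratedLawDichotomyStrainedPatchTaylorSplit
open Summit.AtomisticToContinuum.Crystallization.Theorems.FrustratedLawDichotomyStrainedPatchTaylorPair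
open Summit.AtomisticToContinuum.Crystallization.Theorems.FrustratedLawDichotomyStrainedPatchTaylorChord

open Summit.AtomisticToContinuum.Crystallization.Theorems.FrustratedLawDichotomyStrainedPatchTaylorLeaves

open Summit.AtomisticToContinuum.Crystallization.Theorems.FrustratedLawDichotomyStrainedPatchTaylorRegular
open Summit.AtomisticToContinuum.Crystallization.Theorems.FrustratedLawDichotomyStrainedPatchTaylorKbandKit
open Summit.AtomisticToContinuum.Crystallization.Theorems.FrustratedLawDichotomyStrainedPatchTaylorKband

namespace Summit.AtomisticToContinuum.Crystallization.Theorems.FrustratedLawDichotomyStrainedPatchTaylorTail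


/-! ## §1. Objects: members, outer partners, the rim-cap count -/

/-- The MEMBERS of the frozen average: ball sites whose image is a `9/5`-member of the instance. -/
noncomputable def members {M : ℕ} (z : Fin M → E3) (c : Fin M) {M₁ : ℕ} (z₁ : Fin M₁ → E3) (c₁ : Fin M₁) (e : Fin M → Fin M₁) : Finset (Fin M) :=
  (ball (63 / 10) z c).filter (fun a => e a ∈ ball (9 / 5) z₁ c₁)

/-- The OUTER PARTNERS of a member `a` within range: cluster sites beyond the chart ball (`> 63/10` from the centre) and closer than `9/2` to `z a`. -/
noncomputable def outer {M : ℕ} (z : Fin M → E3) (c a : Fin M) : Finset (Fin M) :=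
  Finset.univ.filter (fun k => 63 / 10 < dist (z k) (z c) ∧ dist (z a) (z k) < 9 / 2)

/-- **(P3b-count) `RimCapCount`** [GEOMETRIC COUNTING] — the weighted rim-cap count `Σ_{a member} (d_a − 9/5)²·#outer(a) / #B_{z₁}(e a) ≤ 2/3`
(`d_a = dist (z a) (z c)`; only members with `d_a > 9/5` have outer partners, and `(d_a − 9/5)² ≤ 1/400` for them). -/
def RimCapCount : Prop :=
  Frame fun _ z c _ z₁ c₁ e => ∑ a ∈ members z c z₁ c₁ e,
    (dist (z a) (z c) - 9 / 5) ^ 2 * ((outer z c a).card : ℝ) / ((ball (9 / 5) z₁ (e a)).card : ℝ) ≤ 2 / 3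

/-- **(P3b-flat) `FlatCapCount`** — the unweighted sufficient form `Σ_{a member} #outer(a) / #B_{z₁}(e a) ≤ 266`. -/
def FlatCapCount : Prop :=
  Frame fun _ z c _ z₁ c₁ e => ∑ a ∈ members z c z₁ c₁ e, ((outer z c a).card : ℝ) / ((ball (9 / 5) z₁ (e a)).card : ℝ) ≤ 266

/-! ## §2. The analytic tail bound: `W₄₅(r) ≥ −3·10⁻⁵·(9/2 − r)²` beyond `89/20` -/

/-- ★ Tail lower bound: for `89/20 ≤ r`, `−(3/100000)(9/2 − r)² ≤ W₄₅(r)` (window `W = V·p`, `V ≥ −(1/6)(20/89)⁶`, `p = (16/27)(9/2−r)²(r−9/4)`; `0` beyond `9/2`). [folklore] -/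
theorem Wrec_tail_lb {r : ℝ} (h : 89 / 20 ≤ r) : -(3 / 100000 * (9 / 2 - r) ^ 2) ≤ Wrec r := by
  have hsq := sq_nonneg (9 / 2 - r)
  by_cases h2 : r ≤ 9 / 2
  · have hw : Wrec r = lennardJones r * ((16 * r ^ 3 - 180 * r ^ 2 + 648 * r - 729) / 27) := effPot45_eq_window (by linarith) h2
    rw [hw, show (16 * r ^ 3 - 180 * r ^ 2 + 648 * r - 729) / 27 = 16 / 27 * (r - 9 / 4) * (9 / 2 - r) ^ 2 by ring]
    have hr0 : 0 < r := by linarith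
    have ht0 : 0 ≤ r⁻¹ := inv_nonneg.2 hr0.le
    have ht : r⁻¹ ≤ (89 / 20 : ℝ)⁻¹ := inv_anti₀ (by norm_num) h
    have ht6 : r⁻¹ ^ 6 ≤ (89 / 20 : ℝ)⁻¹ ^ 6 := pow_le_pow_left₀ ht0 ht 6
    have hV : -(1 / 6 * (89 / 20 : ℝ)⁻¹ ^ 6) ≤ lennardJones r := by
      rw [show lennardJones r = 1 / 12 * r⁻¹ ^ 12 - 1 / 6 * r⁻¹ ^ 6 by simp [lennardJones]]
      nlinarith [pow_nonneg ht0 12]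
    have hV0 : lennardJones r ≤ 0 := lennardJones_nonpos (by linarith)
    have hp0 : 0 ≤ 16 / 27 * (r - 9 / 4) * (9 / 2 - r) ^ 2 := mul_nonneg (mul_nonneg (by norm_num) (by linarith)) hsq
    have hp1 : 16 / 27 * (r - 9 / 4) * (9 / 2 - r) ^ 2 ≤ 16 / 27 * (9 / 4) * (9 / 2 - r) ^ 2 :=
      mul_le_mul_of_nonneg_right (mul_le_mul_of_nonneg_left (by linarith) (by norm_num)) hsq
    have h1 : -(1 / 6 * (89 / 20 : ℝ)⁻¹ ^ 6) * (16 / 27 * (9 / 4) * (9 / 2 - r) ^ 2) ≤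
        lennardJones r * (16 / 27 * (r - 9 / 4) * (9 / 2 - r) ^ 2) := by
      have := mul_le_mul_of_nonneg_right hV hp0
      have := mul_le_mul_of_nonpos_left hp1 (show -(1 / 6 * (89 / 20 : ℝ)⁻¹ ^ 6) ≤ 0 by norm_num)
      linarith
    have hc : 3 / 100000 * (9 / 2 - r) ^ 2 ≥ 1 / 6 * (89 / 20 : ℝ)⁻¹ ^ 6 * (16 / 27 * (9 / 4) * (9 / 2 - r) ^ 2) := by
      rw [← mul_assoc]; exact mul_le_mul_of_nonneg_right (by norm_num) hsq
    linarith
  · rw [show Wrec r = 0 from effPot45_eq_far (by linarith)]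
    have : 0 ≤ 3 / 100000 * (9 / 2 - r) ^ 2 := by positivity
    linarith

/-! ## §3. Members sit within `37/20` of the centre; outer pair terms are bounded below -/

/-- A member lies within `9/5 + δ₀ = 37/20` of the centre (fine chart). [formal bookkeeping] -/
theorem dist_le_of_member {M : ℕ} {z : Fin M → E3} {c : Fin M} {M₁ : ℕ} {z₁ : Fin M₁ → E3} {c₁ : Fin M₁} {e : Fin M → Fin M₁}
    (hf : FineChart delta0 z c z₁ c₁ e) {a : Fin M} (ha : a ∈ members z c z₁ c₁ e) : dist (z a) (z c) ≤ 37 / 20 := by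
  obtain ⟨hab, hae⟩ := Finset.mem_filter.1 ha
  have hd : ‖dev z c z₁ c₁ e a‖ ≤ 1 / 20 := by have := hf a (mem_ball.1 hab); rwa [delta0] at this
  have hi : ‖z₁ (e a) - z₁ c₁‖ ≤ 9 / 5 := by rw [← dist_eq_norm]; exact mem_ball.1 hae
  have hsum : z a - z c = dev z c z₁ c₁ e a + (z₁ (e a) - z₁ c₁) := by rw [dev]; abel
  rw [dist_eq_norm, hsum]
  exact (norm_add_le _ _).trans (by linarith)

/-- ★ An outer pair term of a member is at least `−3·10⁻⁵·(d_a − 9/5)²`; a partner beyond the chart ball but out of range contributes `0`. [folklore] -/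
theorem outer_term_lb {M : ℕ} {z : Fin M → E3} {c : Fin M} {M₁ : ℕ} {z₁ : Fin M₁ → E3} {c₁ : Fin M₁} {e : Fin M → Fin M₁}
    (hf : FineChart delta0 z c z₁ c₁ e) {a : Fin M} (ha : a ∈ members z c z₁ c₁ e) {k : Fin M} (hk : 63 / 10 < dist (z k) (z c)) :
    (if dist (z a) (z k) < 9 / 2 then -(3 / 100000 * (dist (z a) (z c) - 9 / 5) ^ 2) else 0) ≤ Wrec (dist (z a) (z k)) := by
  have hd := dist_le_of_member hf ha
  have htri : dist (z k) (z c) ≤ dist (z a) (z k) + dist (z a) (z c) := by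
    rw [dist_comm (z a) (z k)]; exact dist_triangle _ _ _
  split_ifs with hr
  · have h1 := Wrec_tail_lb (r := dist (z a) (z k)) (by linarith)
    have h2 : (9 / 2 - dist (z a) (z k)) ^ 2 ≤ (dist (z a) (z c) - 9 / 5) ^ 2 :=
      pow_le_pow_left₀ (by linarith) (by linarith) 2
    nlinarith
  · rw [show Wrec (dist (z a) (z k)) = 0 from effPot45_eq_far (not_lt.1 hr)]

/-- The dropped half-sum of a member: `x̃_a − matchSm(ball) a = ½·Σ_{k ∉ ball} W(r_ak)`. [formal bookkeeping] -/
theorem xSm_sub_matchSm {M : ℕ} (z : Fin M → E3) (c a : Fin M) :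
    xSm M z a - matchSm (ball (63 / 10) z c) z a = (∑ k ∈ Finset.univ.filter (fun k => k ∉ ball (63 / 10) z c), Wrec (dist (z a) (z k))) / 2 := by
  have hsplit := Finset.sum_filter_add_sum_filter_not Finset.univ (fun k => k ∈ ball (63 / 10) z c) (fun k => Wrec (dist (z a) (z k)))
  have hS : (Finset.univ.filter fun k => k ∈ ball (63 / 10) z c) = ball (63 / 10) z c := by ext k; simp
  have hps : pairSumFeature Wrec M z a = ∑ k : Fin M, Wrec (dist (z a) (z k)) := rfl
  simp only [xSm, matchSm, hps]
  rw [hS] at hsplit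
  linarith

/-- ★ The dropped half-sum of a member is at least `−(3/200000)·(d_a − 9/5)²·#outer(a)`. [folklore] -/
theorem dropped_member_lb {M : ℕ} {z : Fin M → E3} {c : Fin M} {M₁ : ℕ} {z₁ : Fin M₁ → E3} {c₁ : Fin M₁} {e : Fin M → Fin M₁}
    (hf : FineChart delta0 z c z₁ c₁ e) {a : Fin M} (ha : a ∈ members z c z₁ c₁ e) :
    -(3 / 200000 * (dist (z a) (z c) - 9 / 5) ^ 2 * ((outer z c a).card : ℝ)) ≤ xSm M z a - matchSm (ball (63 / 10) z c) z a := by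
  rw [xSm_sub_matchSm]
  set w : ℝ := 3 / 100000 * (dist (z a) (z c) - 9 / 5) ^ 2 with hw
  have hterm : ∀ k ∈ Finset.univ.filter (fun k => k ∉ ball (63 / 10) z c),
      (if dist (z a) (z k) < 9 / 2 then -w else 0) ≤ Wrec (dist (z a) (z k)) := by
    intro k hk
    have hkc : 63 / 10 < dist (z k) (z c) := by
      have := (Finset.mem_filter.1 hk).2; rw [mem_ball, not_le] at this; exact this
    exact outer_term_lb hf ha hkc
  have hsum := Finset.sum_le_sum hterm
  have hind : ∑ k ∈ Finset.univ.filter (fun k => k ∉ ball (63 / 10) z c), (if dist (z a) (z k) < 9 / 2 then -w else 0) =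
      -w * ((outer z c a).card : ℝ) := by
    rw [← Finset.sum_filter, Finset.filter_filter]
    have hset : Finset.univ.filter (fun k => k ∉ ball (63 / 10) z c ∧ dist (z a) (z k) < 9 / 2) = outer z c a := by
      ext k; simp [outer, mem_ball, not_le]
    rw [hset, Finset.sum_const, nsmul_eq_mul, mul_comm]
  rw [hind] at hsum
  rw [hw] at hsum
  linarith

/-! ## §4. (P3b) from the rim-cap count -/

/-- `frozenAvg − inBallFrozen = Σ_{members} (x̃_a − matchSm(ball) a)/#B(e a)`. [formal bookkeeping] -/
theorem frozenAvg_sub_inBallFrozen {M : ℕ} (z : Fin M → E3) (c : Fin M) {M₁ : ℕ} (z₁ : Fin M₁ → E3) (c₁ : Fin M₁) (e : Fin M → Fin M₁) :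
    frozenAvg z c z₁ c₁ e - inBallFrozen z c z₁ c₁ e =
      ∑ a ∈ members z c z₁ c₁ e, (xSm M z a - matchSm (ball (63 / 10) z c) z a) / ((ball (9 / 5) z₁ (e a)).card : ℝ) := by
  simp only [frozenAvg, inBallFrozen, members, ← Finset.sum_sub_distrib, sub_div]

/-- ★★ **(P3b) ⟸ (P3b-count)**: the rim-cap count gives `inBallFrozen ≤ frozenAvg + 10⁻⁵`. [folklore] -/
theorem beyondBallTail_of_rimCapCount (h : RimCapCount) : BeyondBallTail := by
  intro M z c M₁ z₁ c₁ e t hz hch hf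
  have hX := h M z c M₁ z₁ c₁ e t hz hch hf
  have hdiff := frozenAvg_sub_inBallFrozen z c z₁ c₁ e
  have hsum : ∑ a ∈ members z c z₁ c₁ e,
      -(3 / 200000 * (dist (z a) (z c) - 9 / 5) ^ 2 * ((outer z c a).card : ℝ)) / ((ball (9 / 5) z₁ (e a)).card : ℝ) ≤
      ∑ a ∈ members z c z₁ c₁ e, (xSm M z a - matchSm (ball (63 / 10) z c) z a) / ((ball (9 / 5) z₁ (e a)).card : ℝ) :=
    Finset.sum_le_sum fun a ha => div_le_div_of_nonneg_right (dropped_member_lb hf ha) (Nat.cast_nonneg _)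
  have hscale : ∑ a ∈ members z c z₁ c₁ e,
      -(3 / 200000 * (dist (z a) (z c) - 9 / 5) ^ 2 * ((outer z c a).card : ℝ)) / ((ball (9 / 5) z₁ (e a)).card : ℝ) =
      -(3 / 200000) * ∑ a ∈ members z c z₁ c₁ e,
        (dist (z a) (z c) - 9 / 5) ^ 2 * ((outer z c a).card : ℝ) / ((ball (9 / 5) z₁ (e a)).card : ℝ) := by
    rw [Finset.mul_sum]
    refine Finset.sum_congr rfl fun a _ => ?_
    ring
  rw [hscale] at hsum
  linarith

/-- An occupied outer set forces the member past `9/5`: `outer(a) ≠ ∅ → (d_a − 9/5)² ≤ 1/400`. [formal bookkeeping] -/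
theorem weight_le_of_outer_nonempty {M : ℕ} {z : Fin M → E3} {c : Fin M} {M₁ : ℕ} {z₁ : Fin M₁ → E3} {c₁ : Fin M₁} {e : Fin M → Fin M₁}
    (hf : FineChart delta0 z c z₁ c₁ e) {a : Fin M} (ha : a ∈ members z c z₁ c₁ e) (hne : (outer z c a).Nonempty) :
    (dist (z a) (z c) - 9 / 5) ^ 2 ≤ 1 / 400 := by
  obtain ⟨k, hk⟩ := hne
  obtain ⟨hkc, hr⟩ := (Finset.mem_filter.1 hk).2
  have hd := dist_le_of_member hf ha
  have htri : dist (z k) (z c) ≤ dist (z a) (z k) + dist (z a) (z c) := by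
    rw [dist_comm (z a) (z k)]; exact dist_triangle _ _ _
  rw [show (1 / 400 : ℝ) = (1 / 20) ^ 2 by norm_num]
  exact sq_le_sq' (by linarith) (by linarith)

/-- (P3b-flat) ⟹ (P3b-count): weights are at most `1/400` where the outer set is occupied (`266/400 ≤ 2/3`). [folklore] -/
theorem rimCapCount_of_flat (h : FlatCapCount) : RimCapCount := by
  intro M z c M₁ z₁ c₁ e t hz hch hf
  have hX := h M z c M₁ z₁ c₁ e t hz hch hf
  have hle : ∑ a ∈ members z c z₁ c₁ e, (dist (z a) (z c) - 9 / 5) ^ 2 * ((outer z c a).card : ℝ) / ((ball (9 / 5) z₁ (e a)).card : ℝ) ≤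
      ∑ a ∈ members z c z₁ c₁ e, 1 / 400 * (((outer z c a).card : ℝ) / ((ball (9 / 5) z₁ (e a)).card : ℝ)) := by
    refine Finset.sum_le_sum fun a ha => ?_
    rw [mul_div_assoc]
    by_cases hne : (outer z c a).Nonempty
    · exact mul_le_mul_of_nonneg_right (weight_le_of_outer_nonempty hf ha hne) (by positivity)
    · rw [Finset.not_nonempty_iff_eq_empty.1 hne, Finset.card_empty, Nat.cast_zero, zero_div, mul_zero, mul_zero]
  rw [← Finset.mul_sum] at hle
  linarith

/-! ## §5. The cap lemma: a member's outer partners lie in a ball of radius `123/100`, hence number `≤ 92` -/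

/-- ★ CAP CONTAINMENT: an outer partner `k` of a member `a` (`|z_k − z_c| > 63/10`, `|z_k − z_a| < 9/2`, `|z_a − z_c| ≤ 37/20`) lies within `123/100` of the
point `p_a = z_c + (167/50)(z_a − z_c)` on the member's ray (polarization: `|X − μY|² = (1−μ)|X|² + μ|X−Y|² + (μ²−μ)|Y|²`). [folklore] -/
theorem dist_outer_le {M : ℕ} {z : Fin M → E3} {c a k : Fin M} (hY : dist (z a) (z c) ≤ 37 / 20) (hk : k ∈ outer z c a) :
    dist (z k) (z c + (167 / 50 : ℝ) • (z a - z c)) ≤ 123 / 100 := by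
  obtain ⟨hA, hB⟩ := (Finset.mem_filter.1 hk).2
  have hXn : 63 / 10 < ‖z k - z c‖ := by rwa [← dist_eq_norm]
  have hYn : ‖z a - z c‖ ≤ 37 / 20 := by rwa [← dist_eq_norm]
  have hXY : ‖(z k - z c) - (z a - z c)‖ < 9 / 2 := by
    rw [show (z k - z c) - (z a - z c) = z k - z a by abel, ← dist_eq_norm, dist_comm]; exact hB
  have e1 : ‖(z k - z c) - (z a - z c)‖ ^ 2 = ‖z k - z c‖ ^ 2 - 2 * inner ℝ (z k - z c) (z a - z c) + ‖z a - z c‖ ^ 2 :=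
    norm_sub_sq_real _ _
  have e2 : ‖(z k - z c) - (167 / 50 : ℝ) • (z a - z c)‖ ^ 2 =
      ‖z k - z c‖ ^ 2 - 2 * ((167 / 50 : ℝ) * inner ℝ (z k - z c) (z a - z c)) + (167 / 50) ^ 2 * ‖z a - z c‖ ^ 2 := by
    rw [norm_sub_sq_real, real_inner_smul_right, norm_smul, Real.norm_eq_abs, abs_of_pos (by norm_num : (0:ℝ) < 167 / 50), mul_pow]
  have hA2 : (63 / 10 : ℝ) ^ 2 < ‖z k - z c‖ ^ 2 := by nlinarith [norm_nonneg (z k - z c)]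
  have hB2 : ‖(z k - z c) - (z a - z c)‖ ^ 2 < (9 / 2 : ℝ) ^ 2 := by nlinarith [norm_nonneg ((z k - z c) - (z a - z c))]
  have hY2 : ‖z a - z c‖ ^ 2 ≤ (37 / 20 : ℝ) ^ 2 := by nlinarith [norm_nonneg (z a - z c)]
  have hsq : ‖(z k - z c) - (167 / 50 : ℝ) • (z a - z c)‖ ^ 2 < (123 / 100 : ℝ) ^ 2 := by rw [e2]; linarith
  have hlt : ‖(z k - z c) - (167 / 50 : ℝ) • (z a - z c)‖ < 123 / 100 := lt_of_pow_lt_pow_left₀ 2 (by norm_num) hsq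
  rw [dist_eq_norm, show z k - (z c + (167 / 50 : ℝ) • (z a - z c)) = (z k - z c) - (167 / 50 : ℝ) • (z a - z c) by abel]
  exact hlt.le

/-- ★★ THE CAP LEMMA (crude, volume packing): a member has at most `92` outer partners (`(2·1.23/0.7 + 1)³ < 92`). [folklore] -/
theorem card_outer_le {M : ℕ} {z : Fin M → E3} {c : Fin M} {M₁ : ℕ} {z₁ : Fin M₁ → E3} {c₁ : Fin M₁} {e : Fin M → Fin M₁}
    (hz : Admissible M z c) (hf : FineChart delta0 z c z₁ c₁ e) {a : Fin M} (ha : a ∈ members z c z₁ c₁ e) : ((outer z c a).card : ℝ) ≤ 92 := by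
  have hd := dist_le_of_member hf ha
  have hinj : Function.Injective z := hz.1
  have hsep : Sep z := hz.2.1
  have hcard : ((outer z c a).image z).card = (outer z c a).card := Finset.card_image_of_injective _ hinj
  have h := Literature.MathematicalPhysics.StatisticalMechanics.card_le_of_separated_of_dist_le ((outer z c a).image z) (z c + (167 / 50 : ℝ) • (z a - z c)) (r := 7 / 10) (R := 123 / 100)
    (by norm_num) (by norm_num) ?_ ?_
  · rw [hcard, finrank_euclideanSpace_fin] at h
    exact h.trans (by norm_num)
  · intro x hx
    obtain ⟨k, hk, rfl⟩ := Finset.mem_image.1 hx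
    exact dist_outer_le hd hk
  · intro x hx y hy hxy
    obtain ⟨i, _, rfl⟩ := Finset.mem_image.1 hx
    obtain ⟨j, _, rfl⟩ := Finset.mem_image.1 hy
    exact hsep i j fun hij => hxy (by rw [hij])

/-! ## §6. (P3b-count) from the rim mass of the instance -/

/-- The RIM MEMBERS: members farther than `9/5` from the centre (the only ones with outer partners in range). -/
noncomputable def rimMembers {M : ℕ} (z : Fin M → E3) (c : Fin M) {M₁ : ℕ} (z₁ : Fin M₁ → E3) (c₁ : Fin M₁) (e : Fin M → Fin M₁) : Finset (Fin M) :=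
  (members z c z₁ c₁ e).filter (fun a => 9 / 5 < dist (z a) (z c))

/-- **(P3b-mass) `RimMass`** [INSTANCE GEOMETRY · census] — the rim members' inverse instance-memberships sum to at most `26/9`:
`Σ_{a ∈ rim} 1/#B_{z₁}(e a) ≤ 26/9` (e.g. `≤ 37` rim members with `#B ≥ 13`). With the crude cap lemma (`≤ 92`) and weights `≤ 1/400` it gives (P3b-count). -/
def RimMass : Prop :=
  Frame fun _ z c _ z₁ c₁ e => ∑ a ∈ rimMembers z c z₁ c₁ e, (((ball (9 / 5) z₁ (e a)).card : ℝ))⁻¹ ≤ 26 / 9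

/-- A member with an outer partner is a rim member. [formal bookkeeping] -/
theorem rim_of_outer_nonempty {M : ℕ} {z : Fin M → E3} {c : Fin M} {M₁ : ℕ} {z₁ : Fin M₁ → E3} {c₁ : Fin M₁} {e : Fin M → Fin M₁}
    {a : Fin M} (ha : a ∈ members z c z₁ c₁ e) (hne : (outer z c a).Nonempty) : a ∈ rimMembers z c z₁ c₁ e := by
  obtain ⟨k, hk⟩ := hne
  obtain ⟨hkc, hr⟩ := (Finset.mem_filter.1 hk).2
  have htri : dist (z k) (z c) ≤ dist (z a) (z k) + dist (z a) (z c) := by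
    rw [dist_comm (z a) (z k)]; exact dist_triangle _ _ _
  exact Finset.mem_filter.2 ⟨ha, by linarith⟩

/-- ★★ **(P3b-mass) ⟹ (P3b-count)** (cap lemma + weights). [folklore] -/
theorem rimCapCount_of_rimMass (h : RimMass) : RimCapCount := by
  intro M z c M₁ z₁ c₁ e t hz hch hf
  have hX := h M z c M₁ z₁ c₁ e t hz hch hf
  have hle : ∀ a ∈ members z c z₁ c₁ e,
      (dist (z a) (z c) - 9 / 5) ^ 2 * ((outer z c a).card : ℝ) / ((ball (9 / 5) z₁ (e a)).card : ℝ) ≤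
        if a ∈ rimMembers z c z₁ c₁ e then 23 / 100 * (((ball (9 / 5) z₁ (e a)).card : ℝ))⁻¹ else 0 := by
    intro a ha
    by_cases hne : (outer z c a).Nonempty
    · rw [if_pos (rim_of_outer_nonempty ha hne), div_eq_mul_inv]
      refine mul_le_mul_of_nonneg_right ?_ (by positivity)
      have h1 := weight_le_of_outer_nonempty hf ha hne
      have h2 := card_outer_le hz hf ha
      nlinarith [sq_nonneg (dist (z a) (z c) - 9 / 5), Nat.cast_nonneg (α := ℝ) (outer z c a).card]
    · rw [Finset.not_nonempty_iff_eq_empty.1 hne, Finset.card_empty, Nat.cast_zero, mul_zero, zero_div]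
      split_ifs <;> positivity
  refine (Finset.sum_le_sum hle).trans ?_
  rw [← Finset.sum_filter, show (members z c z₁ c₁ e).filter (fun a => a ∈ rimMembers z c z₁ c₁ e) = rimMembers z c z₁ c₁ e by
    ext a; simp only [rimMembers, Finset.mem_filter]; tauto, ← Finset.mul_sum]
  linarith

/-! ## §7. The rim mass is an INSTANCE-ONLY quantity: (P3b-inst) ⟹ (P3b-mass) -/

/-- The instance's rim sites: `9/5`-members of `c₁` farther than `7/4`. -/
noncomputable def instRim {M₁ : ℕ} (z₁ : Fin M₁ → E3) (c₁ : Fin M₁) : Finset (Fin M₁) :=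
  (ball (9 / 5) z₁ c₁).filter (fun b => 7 / 4 < dist (z₁ b) (z₁ c₁))

/-- **(P3b-inst) `InstanceRimMass`** [INSTANCE GEOMETRY ONLY · census over `𝓘₁⁺`] — for every comparison instance, the rim sites' inverse memberships
sum to at most `26/9`: `Σ_{b : 7/4 < |z₁ b − z₁ c₁| ≤ 9/5} 1/#B_{z₁}(b) ≤ 26/9` (no cluster in the statement). -/
def InstanceRimMass : Prop :=
  ∀ (M₁ : ℕ) (z₁ : Fin M₁ → E3) (c₁ : Fin M₁), CompFamily1 M₁ z₁ c₁ →
    ∑ b ∈ instRim z₁ c₁, (((ball (9 / 5) z₁ b).card : ℝ))⁻¹ ≤ 26 / 9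

/-- A rim member's image is an instance rim site (`|z₁(e a) − z₁ c₁| ≥ d_a − δ₀ > 7/4`). [formal bookkeeping] -/
theorem image_mem_instRim {M : ℕ} {z : Fin M → E3} {c : Fin M} {M₁ : ℕ} {z₁ : Fin M₁ → E3} {c₁ : Fin M₁} {e : Fin M → Fin M₁}
    (hf : FineChart delta0 z c z₁ c₁ e) {a : Fin M} (ha : a ∈ rimMembers z c z₁ c₁ e) : e a ∈ instRim z₁ c₁ := by
  obtain ⟨hm, hd⟩ := Finset.mem_filter.1 ha
  obtain ⟨hab, hae⟩ := Finset.mem_filter.1 hm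
  refine Finset.mem_filter.2 ⟨hae, ?_⟩
  have hdev : ‖dev z c z₁ c₁ e a‖ ≤ 1 / 20 := by have := hf a (mem_ball.1 hab); rwa [delta0] at this
  have hsum : z a - z c = dev z c z₁ c₁ e a + (z₁ (e a) - z₁ c₁) := by rw [dev]; abel
  have h1 : ‖z a - z c‖ ≤ ‖dev z c z₁ c₁ e a‖ + ‖z₁ (e a) - z₁ c₁‖ := by rw [hsum]; exact norm_add_le _ _
  rw [dist_eq_norm] at hd ⊢
  linarith

/-- ★ **(P3b-inst) ⟹ (P3b-mass)**: `e` is injective on members and maps rim members into the instance rim. [folklore] -/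
theorem rimMass_of_instance (h : InstanceRimMass) : RimMass := by
  intro M z c M₁ z₁ c₁ e t hz hch hf
  have hI := h M₁ z₁ c₁ hch.1
  have hinj : Set.InjOn e ↑(rimMembers z c z₁ c₁ e) := by
    intro a ha b hb hab
    have ha' := (Finset.mem_filter.1 (Finset.mem_filter.1 (Finset.mem_coe.1 ha)).1).1
    have hb' := (Finset.mem_filter.1 (Finset.mem_filter.1 (Finset.mem_coe.1 hb)).1).1
    exact hch.2.2.2.2.1 a b (mem_ball.1 ha') (mem_ball.1 hb') hab
  have hsub : (rimMembers z c z₁ c₁ e).image e ⊆ instRim z₁ c₁ := by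
    intro b hb
    obtain ⟨a, ha, rfl⟩ := Finset.mem_image.1 hb
    exact image_mem_instRim hf ha
  calc ∑ a ∈ rimMembers z c z₁ c₁ e, (((ball (9 / 5) z₁ (e a)).card : ℝ))⁻¹
      = ∑ b ∈ (rimMembers z c z₁ c₁ e).image e, (((ball (9 / 5) z₁ b).card : ℝ))⁻¹ :=
        (Finset.sum_image (f := fun b => (((ball (9 / 5) z₁ b).card : ℝ))⁻¹) hinj).symm
    _ ≤ ∑ b ∈ instRim z₁ c₁, (((ball (9 / 5) z₁ b).card : ℝ))⁻¹ :=
        Finset.sum_le_sum_of_subset_of_nonneg hsub fun _ _ _ => by positivity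
    _ ≤ 26 / 9 := hI

/-- ★★ **(P3b) ⟸ (P3b-inst)**: the instance rim-mass bound gives the tail. [folklore] -/
theorem beyondBallTail_of_instanceRimMass (h : InstanceRimMass) : BeyondBallTail :=
  beyondBallTail_of_rimCapCount (rimCapCount_of_rimMass (rimMass_of_instance h))

/-! ## §8. Seams for node (T2-bent₁) -/

/-- (T2-bent₁) from the weighted rim-cap count. [folklore] -/
theorem taylorTwoBent1_of_rimCapCount (h : RimCapCount) : TaylorTwoBent1 := taylorTwoBent1_of_tail (beyondBallTail_of_rimCapCount h)

/-- ★★★ (T2-bent₁) from the INSTANCE-ONLY rim mass: `InstanceRimMass → TaylorTwoBent1` — every cluster-side piece of the node is proved. [folklore] -/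
theorem taylorTwoBent1_of_instanceRimMass (h : InstanceRimMass) : TaylorTwoBent1 := taylorTwoBent1_of_tail (beyondBallTail_of_instanceRimMass h)

end Summit.AtomisticToContinuum.Crystallization.Theorems.FrustratedLawDichotomyStrainedPatchTaylorTail
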